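import Summits.BirchSwinnertonDyer.BirchSwinnertonDyer.Theorems.GoldfeldAllTwistsTwoConverseTwinAdditiveSplitPrimeTwistSelmer
import Summits.BirchSwinnertonDyer.BirchSwinnertonDyer.Theorems.GoldfeldAllTwistsTwoConverseTwinAdditiveInertTwistDescent
import HarnessLib

set_option linter.dupNamespace false -- namespace `…BirchSwinnertonDyer.BirchSwinnertonDyer…` is the cell's (D-0017 nested layout)
set_option autoImplicit false

/-!
# Twin″ (item 19140), IX: `rank ≤ 1`, `Ш[2] = 0` in rank one, and `BSD(W,2)` as a `2`-adic unit
# statement for `49a1^{(−ℓ)}`, `ℓ ≡ 5 (mod 8)` prime SPLIT in `ℚ(√−7)`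

Cell `bsd-goldfeld`, seat `bsd-goldfeld-s1p-c301` (gen 2); `--supports stmt-BirchSwinnertonDyer-19140`. From
part VIII (`#S(−21ℓ,112ℓ²) ≤ 4`, `#S(42ℓ,−7ℓ²) ≤ 2`) and part VII's counting / transport lemmas
(`rank_le_one_and_sha_parts_of_card_mul_le`, `rank_le_one_and_sha_two_of_smul_eq`,
`smul_eq_twoTorsionModel_of_smul_eq_quadraticTwist`, `bsdp_two_iff_shaAn_unit_of_forall_mem_sha`): for
every model `W/ℚ` of `49a1^{(−ℓ)}` (`C • W = cm7.quadraticTwist (−ℓ)`), `ℓ ≡ 5 (mod 8)` prime with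
`(−7/ℓ) = +1`:

* `rank W(ℚ) ≤ 1` UNCONDITIONALLY and `rank W(ℚ) = 1 ⇒ Ш(W/ℚ)[2] = 0`
  (`rank_le_one_and_sha_two_splitPrimeTwist`);
* in analytic rank one, granted GZK (`hGZK`): `rank = 1`, `Ш(W)[2^∞] = 0`, `corank_{ℤ₂} Sel_{2^∞}(W) = 1`
  and **`BSD(W,2) ⟺ ∃ q : ℚ, #Ш_an(W) = q ∧ ord₂ q = 0`** (`bsdp_two_iff_shaAn_unit_splitPrimeTwist`).

With parts II/VII this covers, inside the additive cell `r1.addv.borel.split`, the prime twists `49a1^{(−ℓ)}`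
for ALL primes `ℓ ≡ 5 (mod 8)` prime to `7` (inert or split) and the inert ones `≡ 1 (mod 8)`; the split
`ℓ ≡ 1 (mod 8)` are genuinely different (`Ш[2] ≠ 0` occurs). HONEST FRAMING: no `BSD(W,2)` is proved;
BSD is not proved by any of this.

## References

* J. H. Silverman, *The Arithmetic of Elliptic Curves*, 2nd ed. (2009), Thm. X.4.2(a), Prop. X.4.9.
  [SilvermanAEC2009]
* R. L. Miller, LMS J. Comput. Math. 14 (2011), Def. 1.1. [Miller2011LMS]
-/

noncomputable section

open scoped Classical

open WeierstrassCurve Literature.NumberTheory.EllipticCurves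

namespace Summit.BirchSwinnertonDyer.BirchSwinnertonDyer.Theorems.GoldfeldGoodTwists

/-- **`rank E_{−ℓ}(ℚ) ≤ 1`, and `rank = 1 ⇒ Ш(E_{−ℓ}/ℚ)[2] = 0`** (UNCONDITIONAL) for the two-torsion
model `E_{−ℓ} : y² = x³ − 21ℓx² + 112ℓ²x`, `ℓ ≡ 5 (mod 8)` prime with `(−7/ℓ) = +1` (`#S · #S' ≤ 8`).
[cite: SilvermanAEC2009, Thm. X.4.2(a), Prop. X.4.9] -/
theorem rank_le_one_and_sha_two_twoTorsionModel_splitPrimeTwist {l : ℕ} [Fact l.Prime]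
    (hl8 : l % 8 = 5) (hl7 : legendreSym l (-7) = 1)
    [hE : (⟨0, ((-21 * l : ℤ) : ℚ), 0, ((112 * l ^ 2 : ℤ) : ℚ), 0⟩ : WeierstrassCurve ℚ).IsElliptic] :
    (⟨0, ((-21 * l : ℤ) : ℚ), 0, ((112 * l ^ 2 : ℤ) : ℚ), 0⟩ : WeierstrassCurve ℚ).mordellWeilRank ≤ 1 ∧
      ((⟨0, ((-21 * l : ℤ) : ℚ), 0, ((112 * l ^ 2 : ℤ) : ℚ), 0⟩ : WeierstrassCurve ℚ).mordellWeilRank = 1 →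
        ∀ c ∈ (⟨0, ((-21 * l : ℤ) : ℚ), 0, ((112 * l ^ 2 : ℤ) : ℚ), 0⟩ : WeierstrassCurve ℚ).sha,
          2 • c = 0 → c = 0) := by
  have hl : l.Prime := Fact.out
  have hab := hab_inertTwist hl.pos
  haveI := isElliptic_halfModel hab
  have hS := card_twoIsogenySelmerGroup_splitPrimeTwist_le hl8 hl7
  have hS' := card_twoIsogenySelmerGroup'_splitPrimeTwist_le hl8 hl7
  obtain ⟨hr, hparts⟩ := rank_le_one_and_sha_parts_of_card_mul_le hab
    (by nlinarith [hS, hS', Nat.zero_le (twoIsogenySelmerGroup (-21 * l) (112 * l ^ 2)).card])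
  refine ⟨hr, fun h => ?_⟩
  obtain ⟨h₀, h₁⟩ := hparts h
  exact forall_mem_sha_two_smul_eq_zero_of_halfModel h₀ h₁

/-- **UNCONDITIONAL: `rank W(ℚ) ≤ 1`, and `rank W(ℚ) = 1 ⇒ Ш(W/ℚ)[2] = 0`, for every model `W` of
`49a1^{(−ℓ)}`**, `ℓ ≡ 5 (mod 8)` prime with `(−7/ℓ) = +1`.
[cite: SilvermanAEC2009, Thm. X.4.2(a), Prop. X.4.9, Thm. III.6.2(a)] -/
theorem rank_le_one_and_sha_two_splitPrimeTwist {l : ℕ} [Fact l.Prime] (hl8 : l % 8 = 5)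
    (hl7 : legendreSym l (-7) = 1) (W : WeierstrassCurve ℚ) [W.IsElliptic] (C : VariableChange ℚ)
    (hC : C • W = cm7.quadraticTwist ((-l : ℤ) : ℚ)) :
    W.mordellWeilRank ≤ 1 ∧ (W.mordellWeilRank = 1 → ∀ c ∈ W.sha, 2 • c = 0 → c = 0) := by
  have hl : l.Prime := Fact.out
  haveI := isElliptic_mk_of_ne_zero (F := ℚ) (hab_inertTwist hl.pos)
  have hE := (smul_eq_twoTorsionModel_of_smul_eq_quadraticTwist (-l) W C hC).trans
    (show (⟨0, ((21 * (-l : ℤ) : ℤ) : ℚ), 0, ((112 * (-l : ℤ) ^ 2 : ℤ) : ℚ), 0⟩ : WeierstrassCurve ℚ) =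
        ⟨0, ((-21 * l : ℤ) : ℚ), 0, ((112 * l ^ 2 : ℤ) : ℚ), 0⟩ by ext <;> push_cast <;> ring)
  exact rank_le_one_and_sha_two_of_smul_eq W _ _ hE
    (rank_le_one_and_sha_two_twoTorsionModel_splitPrimeTwist hl8 hl7)

/-- **Twin″ on the split prime-twist family `49a1^{(−ℓ)}`, `ℓ ≡ 5 (mod 8)`, `(−7/ℓ) = +1`**: for every
model `W` of analytic rank `1`, granted GZK: `rank = 1`, `Ш(W)[2^∞] = 0`, `corank_{ℤ₂} Sel_{2^∞}(W) = 1`,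
and `BSD(W,2) ⟺ ∃ q : ℚ, #Ш_an(W) = q ∧ ord₂ q = 0`. [cite: SilvermanAEC2009, Thm. X.4.2(a), Prop. X.4.9]
[cite: Miller2011LMS, Def. 1.1] [cite: Greenberg1999LNM, §1 pp. 54–57] -/
theorem bsdp_two_iff_shaAn_unit_splitPrimeTwist (hGZK : rank_eq_analyticRank_of_analyticRank_le_one)
    {l : ℕ} [Fact l.Prime] (hl8 : l % 8 = 5) (hl7 : legendreSym l (-7) = 1)
    (W : WeierstrassCurve ℚ) [W.IsElliptic] (C : VariableChange ℚ)
    (hC : C • W = cm7.quadraticTwist ((-l : ℤ) : ℚ)) (har : W.analyticRank = 1) :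
    W.mordellWeilRank = 1 ∧ AddCommGroup.primaryComponent W.sha 2 = ⊥ ∧ W.selmerCorank 2 = 1 ∧
      (BSDp W 2 ↔ ∃ q : ℚ, shaAn W = (q : ℂ) ∧ padicValRat 2 q = 0) := by
  haveI : Fact (Nat.Prime 2) := ⟨Nat.prime_two⟩
  have hrank : W.mordellWeilRank = W.analyticRank := (hGZK W (by rw [har])).1
  have hr : W.mordellWeilRank = 1 := by rw [hrank, har]
  have h2 := (rank_le_one_and_sha_two_splitPrimeTwist hl8 hl7 W C hC).2 hr
  obtain ⟨hbot, hiff⟩ := bsdp_two_iff_shaAn_unit_of_forall_mem_sha W h2 hrank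
  refine ⟨hr, hbot, ?_, hiff⟩
  rw [W.selmerCorank_eq_mordellWeilRank_add_holds 2, hr, W.shaCorank_eq_zero_of_forall 2 h2]

end Summit.BirchSwinnertonDyer.BirchSwinnertonDyer.Theorems.GoldfeldGoodTwists

end
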